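import Mathlib
import Literature.Computability.AlgebraicComplexity.ASSS16DerivativeAlgebra
import Literature.Computability.AlgebraicComplexity.FSV18OccurModelViews
import HarnessLib

/-!
# [ASSS16] Lemma 4.1 (gcd trick) for the gates of FSV's occur-`k` formulas — proofs only

M. Agrawal, C. Saha, R. Saptharishi, N. Saxena, arXiv:1111.0582 [AgrawalEtAl2011], §4 Lemma 4.1
(= §7.3 `lem:derivative-content`, p0009:L84–L97, proof p0018:L39–L62):

> Let `G` be any gate in `C` and `S_1, ⋯, S_w` be multisets of variables. Then there exists another
> occur-`k` formula `G'` for which the vector of polynomials `(Δ_{S_1} G, ⋯, Δ_{S_w} G) =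
> V_G · (Δ_{S_1}G', ⋯, Δ_{S_w}G')` such that: if `G` is a `+` gate then `G'` is also a `+` gate
> whose children consist of at most `k · |∪_i var(S_i)|` of the children of `G`, and `V_G = 1`; if
> `G` is a `×∧` gate, then `G'` is also a `×∧` gate whose children consist of at most
> `k · |∪_i var(S_i)|` of the children of `G`, and `V_G = G/G'`. Further, the gates constituting
> `G'` and `V_G` are disjoint.

Typed for the tree's model of FSV Def. 45 (`OccurFormula`, `FSV18SuccinctGenerators.lean`), as the
instantiation of the polynomial-level factorizations of `ASSS16DerivativeAlgebra.lean` through the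
indexed-family views of `FSV18OccurModelViews.lean`: the children of the gate are an indexed family
`φ : Fin m → OccurFormula` (with exponents `e` for a `×∧` gate), `G'` is the sub-family of the
children whose polynomial involves a variable of `V ⊇ ∪_i var(S_i)` (a `Finset.filter`, so "`G'` and
`V_G` disjoint" is by construction), its size is `≤ k·|V|`, and the factorization holds for EVERY
multiset `β` supported in `V` (one `V_G` for the whole family `S_1, …, S_w`). `G'` is not rebuilt as
an `OccurFormula` term: its members are the sub-formulas `φ j` themselves (what the level recursion of
Lemma 4.2 / Cor. 4.3 descends into).

* `ASSS16.gcdTrick_powProd` — the `×∧` case; * `ASSS16.gcdTrick_add` — the `+` case (`β ≠ 0`).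

No definitions, no named facts. Honest framing: bookkeeping for the N1 occur push (FSV Thm. 48 /
Cor. 49 bypass); nothing here bears on `VP ≠ VNP`.

## References
* [AgrawalEtAl2011] arXiv:1111.0582 §4 Lemma 4.1, proof §7.3 (locator: paper:arxiv-1111.0582
  p0009.txt:L84–L97; p0018.txt:L39–L62).
* [ForbesShpilkaVolk2018] Def. 45 (seq.) = ToC Def. 5.21 — the formula model.
-/

noncomputable section

namespace Literature.Computability.AlgebraicComplexity

namespace ASSS16

open MvPolynomial Finset

open scoped BigOperators

open Literature.RepresentationTheory.AlgebraicGroups (iterPderiv)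

variable {F : Type*} [Field F] {ι : Type*} [DecidableEq ι]

/-- **[ASSS16, Lemma 4.1 (gcd trick)], `×∧` gate of an occur-`k` formula.** Write the gate as
`G = ∏_j (φ j)^{e_j}` over its indexed family of children; let `P` = the children whose polynomial
involves a variable of `V`. Then `|P| ≤ k·|V|`, the other children involve no variable of `V`, and for
every multiset `β` of variables from `V`: `Δ_β G = V_G · Δ_β G'` with `G' = ∏_{j ∈ P} (φ j)^{e_j}` and
`V_G = ∏_{j ∉ P} (φ j)^{e_j} = G/G'`.
[cite: AgrawalEtAl2011, Lemma 4.1 (= lem:derivative-content), second bullet]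
locator: paper:arxiv-1111.0582 p0009.txt:L93–L97; p0018.txt:L58–L62 -/
theorem gcdTrick_powProd (ps : OccurPowArgs F ι) {k : ℕ}
    (hk : ∀ i, (OccurFormula.powProd ps).occur i ≤ k) (V : Finset ι) :
    ∃ (m : ℕ) (φ : Fin m → OccurFormula F ι) (e : Fin m → ℕ),
      ps.evalProd = ∏ j, (φ j).eval ^ e j ∧
      (∀ i, ps.occur i = ∑ j, (φ j).occur i) ∧
      ps.size = ∑ j, (e j + (φ j).size) ∧
      (∀ j, (φ j).depth ≤ ps.depth) ∧
      (Finset.univ.filter fun j => ∃ i ∈ V, i ∈ (φ j).eval.vars).card ≤ k * V.card ∧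
      (∀ j, j ∉ (Finset.univ.filter fun j => ∃ i ∈ V, i ∈ (φ j).eval.vars) →
        ∀ i ∈ V, i ∉ (φ j).eval.vars) ∧
      ∀ β : ι →₀ ℕ, β.support ⊆ V →
        iterPderiv (A := F) β ps.evalProd =
          (∏ j ∈ Finset.univ.filter (fun j => ¬ ∃ i ∈ V, i ∈ (φ j).eval.vars), (φ j).eval ^ e j) *
            iterPderiv (A := F) β
              (∏ j ∈ Finset.univ.filter (fun j => ∃ i ∈ V, i ∈ (φ j).eval.vars), (φ j).eval ^ e j) := by
  classical
  obtain ⟨m, φ, e, hev, hocc, hsz, hdp⟩ := OccurPowArgs.exists_fin_view ps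
  refine ⟨m, φ, e, hev, hocc, hsz, hdp, ?_, ?_, fun β hβ => ?_⟩
  · refine card_filter_dependsOn_le Finset.univ (fun j => (φ j).eval) V k fun i _ => ?_
    exact OccurPowArgs.card_filter_mem_vars_le ps φ hocc hk i
  · intro j hj i hiV hij
    exact hj (Finset.mem_filter.mpr ⟨Finset.mem_univ _, i, hiV, hij⟩)
  · rw [hev]
    refine iterPderiv_prod_pow_eq_mul_filter Finset.univ (fun j => (φ j).eval) e β
      (fun j => ∃ i ∈ V, i ∈ (φ j).eval.vars) (fun j _ hj i hi hij => ?_)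
    exact hj ⟨i, hβ hi, hij⟩

/-- **[ASSS16, Lemma 4.1 (gcd trick)], `+` gate of an occur-`k` formula.** `G = Σ_j (φ j)`; with `P`
as above, `|P| ≤ k·|V|` and for every NONEMPTY multiset `β` of variables from `V`:
`Δ_β G = Δ_β G'`, `G' = Σ_{j ∈ P} (φ j)` (`V_G = 1`).
[cite: AgrawalEtAl2011, Lemma 4.1 (= lem:derivative-content), first bullet]
locator: paper:arxiv-1111.0582 p0009.txt:L89–L92; p0018.txt:L53–L56 -/
theorem gcdTrick_add (as : OccurArgs F ι) {k : ℕ}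
    (hk : ∀ i, (OccurFormula.add as).occur i ≤ k) (V : Finset ι) :
    ∃ (m : ℕ) (φ : Fin m → OccurFormula F ι),
      as.evalSum = ∑ j, (φ j).eval ∧
      (∀ i, as.occur i = ∑ j, (φ j).occur i) ∧
      as.size = ∑ j, (φ j).size ∧
      (∀ j, (φ j).depth ≤ as.depth) ∧
      (Finset.univ.filter fun j => ∃ i ∈ V, i ∈ (φ j).eval.vars).card ≤ k * V.card ∧
      (∀ j, j ∉ (Finset.univ.filter fun j => ∃ i ∈ V, i ∈ (φ j).eval.vars) →
        ∀ i ∈ V, i ∉ (φ j).eval.vars) ∧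
      ∀ β : ι →₀ ℕ, β ≠ 0 → β.support ⊆ V →
        iterPderiv (A := F) β as.evalSum =
          ∑ j ∈ Finset.univ.filter (fun j => ∃ i ∈ V, i ∈ (φ j).eval.vars),
            iterPderiv (A := F) β (φ j).eval := by
  classical
  obtain ⟨m, φ, hev, hocc, hsz, hdp⟩ := OccurArgs.exists_fin_view as
  refine ⟨m, φ, hev, hocc, hsz, hdp, ?_, ?_, fun β hβ0 hβ => ?_⟩
  · refine card_filter_dependsOn_le Finset.univ (fun j => (φ j).eval) V k fun i _ => ?_
    exact OccurArgs.card_filter_mem_vars_le as φ hocc hk i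
  · intro j hj i hiV hij
    exact hj (Finset.mem_filter.mpr ⟨Finset.mem_univ _, i, hiV, hij⟩)
  · rw [hev]
    refine iterPderiv_sum_eq_sum_filter Finset.univ (fun j => (φ j).eval) hβ0
      (fun j => ∃ i ∈ V, i ∈ (φ j).eval.vars) (fun j _ hj i hi hij => ?_)
    exact hj ⟨i, hβ hi, hij⟩

/-- The variable set `V = ∪_t var(S_t)` of a finite family of multisets contains each `var(S_t)`
("`S_1, ⋯, S_w` be multisets of variables … `∪_{i=1}^{w} var(S_i)`").
[cite: AgrawalEtAl2011, Lemma 4.1 (= lem:derivative-content), statement] locator: paper:arxiv-1111.0582 p0009.txt:L84–L92 -/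
theorem support_subset_biUnion_support {T : Type*} (s : Finset T) (β : T → ι →₀ ℕ) {t : T}
    (ht : t ∈ s) : (β t).support ⊆ s.biUnion fun t => (β t).support :=
  Finset.subset_biUnion_of_mem (fun t => (β t).support) ht

end ASSS16

end Literature.Computability.AlgebraicComplexity
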